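import Literature.RingTheory.SymmetricFunctions.SchurPolynomials
import Literature.NumberTheory.DiophantineGeometry.TensorWordModel
import HarnessLib

/-!
# Fixed words of a permutation and Frobenius's alternating coefficient

Topic `Literature/RepresentationTheory/FiniteGroups`. This file sets up the two combinatorial
objects through which Frobenius's character formula for the symmetric groups is stated and proved
in the sibling files `SymmetricGroupFrobeniusOrthogonality.lean`, `SymmetricGroupFrobeniusFormula.lean`
(Frobenius 1900; Fulton–Harris, *Representation Theory*, §4.1 formula (4.10) and §4.3; Macdonald,
*Symmetric Functions and Hall Polynomials*, Ch. I §7):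

* `fixedWordPoly N σ = F_σ(x) = ∑_{w : ι → [N], w ∘ σ = w} x^{cont(w)} ∈ ℤ[x_1, …, x_N]`, the
  enumerator of the words (maps) on a finite position set `ι` fixed by `σ ∈ 𝔖_ι`, by content. A
  word is fixed by `σ` iff it is constant on the cycles of `σ`, so `F_σ = ∏_{c} p_{|c|}(x)` is the
  power-sum product `p_{ρ(σ)}` of the cycle type (Fulton–Harris §4.1, "`P_j(x) = x_1^j + ⋯ + x_k^j`");
  the coefficient of `x^η` in `F_σ` is the number of fixed words of content `η`, i.e. the value at
  `σ` of the permutation character of `𝔖_D` on words of content `η` (the induced character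
  `Ind_{𝔖_η}^{𝔖_D} 1`, Fulton–Harris (4.33) `ψ_λ`): `coeff_fixedWordPoly`.
* `frobeniusChar N lam σ = [x^{lam + ρ}] (a_ρ(x) · F_σ(x)) ∈ ℤ`, with `ρ = (N-1, …, 1, 0)` and
  `a_ρ = ∑_τ sign(τ) x^{τρ}` the Vandermonde alternant (the tree's `alternant`, `rho` of
  `Literature/RingTheory/SymmetricFunctions/SchurPolynomials.lean`, taken at the generic point
  `x = X`): this is the right-hand side `[Δ(x) · ∏_j P_j(x)^{i_j}]_{(λ_1 + N - 1, …, λ_N)}` of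
  Frobenius's formula (Fulton–Harris Thm. 4.10 / formula (4.10)), written, by expanding the
  alternant, as the alternating sum of fixed-word counts
  `∑_{τ ∈ 𝔖_N} sign(τ) · #{w : w ∘ σ = w, ρ(τ j) + cont(w)_j = lam_j + ρ_j ∀ j}`
  (`frobeniusChar_eq_sum_sign_mul_card`; the determinantal / permutation-module form
  `χ^λ = ∑_τ sign(τ) Ind_{𝔖_{λ+ρ-τρ}} 1`, Fulton–Harris (4.39)–(4.41), Macdonald I (7.4)–(7.6)).

Everything here is elementary bookkeeping (finite sums of monomials); the representation theory is
in the sibling files. Also proved: invariance of `F_σ` under relabelling the positions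
(`fixedWordPoly_permCongr`) and the letters (`rename_fixedWordPoly`).

## References

* W. Fulton, J. Harris, *Representation Theory. A First Course*, GTM 129 (1991), §4.1 (4.10),
  §4.3 ((4.33), Lemma 4.39–(4.41)). [FultonHarrisGTM129]
* I. G. Macdonald, *Symmetric Functions and Hall Polynomials*, 2nd ed. (1995), Ch. I §7.
  [Macdonald1995]

## Mathlib and tree

Mathlib: `MvPolynomial.monomial`, `coeff_monomial`, `monomial_mul`, `rename`,
`Finsupp.equivFunOnFinite`, `Equiv.permCongr`, `Equiv.Perm.sign`. Tree: `alternant`,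
`alternant_eq_sum`, `rho` (`SchurPolynomials.lean`); `Word`, `wordContent` (`TensorWordModel.lean`).
Mathlib has no Frobenius formula, permutation characters of Young subgroups or cycle-index
enumerators (checked: `lean search 'Frobenius character formula|cycle index|permutation character'`).
-/

noncomputable section

open scoped BigOperators
open MvPolynomial Finset
open Literature.RingTheory.SymmetricFunctions.SymmPoly (alternant alternant_eq_sum rho)
open Literature.NumberTheory.DiophantineGeometry (Word wordContent)

namespace Literature.RepresentationTheory.FiniteGroups

section Content

variable {ι κ : Type*} [Fintype ι] [Fintype κ] {N : ℕ}

/-! ### Contents of words as exponent vectors -/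

/-- The content of a word `w : ι → [N]` as an exponent vector `Fin N →₀ ℕ`: letter `i` occurs
`#{p | w p = i}` times (for `ι = Fin D` this is the tree's `wordContent`, `wordExps_apply_eq_wordContent`).
[folklore] -/
def wordExps (N : ℕ) (w : ι → Fin N) : Fin N →₀ ℕ :=
  Finsupp.equivFunOnFinite.symm fun i => (univ.filter fun p => w p = i).card

/-- Unfolding `wordExps`. [folklore] -/
@[simp] theorem wordExps_apply (w : ι → Fin N) (i : Fin N) :
    wordExps N w i = (univ.filter fun p => w p = i).card := by
  simp [wordExps]

/-- On `Word N D = (Fin D → Fin N)` the exponent vector is the tree's `wordContent`. [folklore] -/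
theorem wordExps_apply_eq_wordContent {D : ℕ} (w : Word N D) (i : Fin N) :
    wordExps N w i = wordContent w i := by
  rw [wordExps_apply]; rfl

/-- Relabelling the positions does not change the content. [folklore] -/
theorem wordExps_comp_equiv (w : ι → Fin N) (e : κ ≃ ι) : wordExps N (w ∘ e) = wordExps N w := by
  ext i
  simp only [wordExps_apply, Function.comp_apply]
  exact Finset.card_equiv e fun p => by simp

/-- Relabelling the letters by `g ∈ 𝔖_N` relabels the content: `cont(g ∘ w) = cont(w) ∘ g⁻¹`,
i.e. `cont(g ∘ w) = mapDomain g (cont w)`. [folklore] -/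
theorem wordExps_perm_comp (g : Equiv.Perm (Fin N)) (w : ι → Fin N) :
    wordExps N (g ∘ w) = Finsupp.mapDomain g (wordExps N w) := by
  ext i
  rw [Finsupp.mapDomain_equiv_apply, wordExps_apply, wordExps_apply]
  congr 1
  ext p
  simp only [mem_filter, mem_univ, true_and, Function.comp_apply, Equiv.eq_symm_apply]

/-- The monomial of a word: `∏_p x_{w p} = x^{cont(w)}`. [folklore] -/
theorem prod_X_eq_monomial (w : ι → Fin N) :
    ∏ p, (X (w p) : MvPolynomial (Fin N) ℤ) = monomial (wordExps N w) 1 := by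
  rw [← Finset.prod_fiberwise' univ w (fun i => (X i : MvPolynomial (Fin N) ℤ))]
  simp_rw [Finset.prod_const]
  rw [monomial_eq, C_1, one_mul, Finsupp.prod_fintype _ _ (fun i => pow_zero _)]
  simp

end Content

section Fixed

variable {ι κ : Type*} [Fintype ι] [DecidableEq ι] [Fintype κ] [DecidableEq κ] {N : ℕ}

/-! ### The fixed-word enumerator `F_σ` -/

/-- **The fixed-word enumerator** `F_σ(x) = ∑_{w : ι → [N], w ∘ σ = w} ∏_p x_{w p}` of a
permutation `σ` of a finite set `ι`: the generating polynomial, by content, of the words fixed by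
`σ` (equivalently `∏_{cycles c of σ} p_{|c|}(x)`, Fulton–Harris §4.1; as a class function of `σ`
its `x^η`-coefficient is the permutation character `Ind_{𝔖_η} 1`, Fulton–Harris (4.33)).
[cite: FultonHarrisGTM129, §4.1 (4.10) and §4.3 (4.33)] -/
def fixedWordPoly (N : ℕ) (σ : Equiv.Perm ι) : MvPolynomial (Fin N) ℤ :=
  ∑ w ∈ univ.filter (fun w : ι → Fin N => w ∘ ⇑σ = w), ∏ p, X (w p)

/-- `F_σ = ∑_{w ∘ σ = w} x^{cont(w)}`. [folklore] -/
theorem fixedWordPoly_eq_sum_monomial (σ : Equiv.Perm ι) :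
    fixedWordPoly N σ =
      ∑ w ∈ univ.filter (fun w : ι → Fin N => w ∘ ⇑σ = w), monomial (wordExps N w) 1 := by
  unfold fixedWordPoly
  exact Finset.sum_congr rfl fun w _ => prod_X_eq_monomial w

/-- **The coefficients of `F_σ` are fixed-word counts**: `[x^η] F_σ = #{w | w ∘ σ = w, cont w = η}`
(the value at `σ` of the permutation character of `𝔖_ι` on the words of content `η`).
[cite: FultonHarrisGTM129, §4.3 (4.33)] -/
theorem coeff_fixedWordPoly (σ : Equiv.Perm ι) (η : Fin N →₀ ℕ) :
    coeff η (fixedWordPoly N σ) =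
      ((univ.filter fun w : ι → Fin N => w ∘ ⇑σ = w ∧ wordExps N w = η).card : ℤ) := by
  rw [fixedWordPoly_eq_sum_monomial, coeff_sum]
  simp_rw [coeff_monomial]
  rw [Finset.sum_ite, Finset.sum_const_zero, add_zero, Finset.sum_const, nsmul_eq_mul, mul_one,
    Finset.filter_filter]

/-- Relabelling the positions along `e : ι ≃ κ` does not change `F_σ`:
`F_{e σ e⁻¹} = F_σ`. [folklore] -/
theorem fixedWordPoly_permCongr (e : ι ≃ κ) (σ : Equiv.Perm ι) :
    fixedWordPoly N (e.permCongr σ) = fixedWordPoly N σ := by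
  unfold fixedWordPoly
  rw [Finset.sum_filter, Finset.sum_filter]
  refine Fintype.sum_equiv (Equiv.arrowCongr e.symm (Equiv.refl (Fin N))) _ _ fun w => ?_
  have hw : (Equiv.arrowCongr e.symm (Equiv.refl (Fin N))) w = w ∘ ⇑e := by
    ext p; simp [Equiv.arrowCongr_apply]
  rw [hw]
  have hiff : w ∘ ⇑(e.permCongr σ) = w ↔ (w ∘ ⇑e) ∘ ⇑σ = w ∘ ⇑e := by
    constructor
    · intro h
      funext p
      have := congr_fun h (e p)
      simpa [Equiv.permCongr_apply] using this
    · intro h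
      funext x
      have := congr_fun h (e.symm x)
      simpa [Equiv.permCongr_apply] using this
  by_cases h : w ∘ ⇑(e.permCongr σ) = w
  · rw [if_pos h, if_pos (hiff.1 h)]
    exact (Equiv.prod_comp e (fun x => (X (w x) : MvPolynomial (Fin N) ℤ))).symm
  · rw [if_neg h, if_neg (fun h' => h (hiff.2 h'))]

/-- Relabelling the letters does not change `F_σ`: `F_σ(x_{g 1}, …, x_{g N}) = F_σ(x)`, i.e.
`F_σ` is a symmetric polynomial. [folklore] -/
theorem rename_fixedWordPoly (g : Equiv.Perm (Fin N)) (σ : Equiv.Perm ι) :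
    rename g (fixedWordPoly N σ) = fixedWordPoly N σ := by
  unfold fixedWordPoly
  rw [Finset.sum_filter, map_sum]
  refine Fintype.sum_equiv (Equiv.arrowCongr (Equiv.refl ι) g) _ _ fun w => ?_
  have hw : (Equiv.arrowCongr (Equiv.refl ι) g) w = ⇑g ∘ w := by
    ext p; simp [Equiv.arrowCongr_apply]
  rw [hw]
  have hiff : w ∘ ⇑σ = w ↔ (⇑g ∘ w) ∘ ⇑σ = ⇑g ∘ w := by
    constructor
    · intro h
      rw [Function.comp_assoc, h]
    · intro h
      funext p
      exact g.injective (congr_fun h p)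
  by_cases h : w ∘ ⇑σ = w
  · rw [if_pos h, if_pos (hiff.1 h), map_prod]
    simp
  · rw [if_neg h, if_neg (fun h' => h (hiff.2 h')), map_zero]

/-! ### The alternant at the generic point -/

/-- The exponent vector `j ↦ μ (τ⁻¹ j)` of the monomial `∏_i x_{τ i}^{μ_i}`. [folklore] -/
theorem prod_X_pow_perm_eq_monomial (μ : Fin N → ℕ) (τ : Equiv.Perm (Fin N)) :
    ∏ i, (X (τ i) : MvPolynomial (Fin N) ℤ) ^ μ i =
      monomial (Finsupp.equivFunOnFinite.symm fun j => μ (τ⁻¹ j)) 1 := by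
  have h1 : ∏ i, (X (τ i) : MvPolynomial (Fin N) ℤ) ^ μ i =
      ∏ j, (X j : MvPolynomial (Fin N) ℤ) ^ μ (τ⁻¹ j) := by
    rw [← Equiv.prod_comp τ (fun j => (X j : MvPolynomial (Fin N) ℤ) ^ μ (τ⁻¹ j))]
    simp
  rw [h1, monomial_eq, C_1, one_mul, Finsupp.prod_fintype _ _ (fun i => pow_zero _)]
  simp

/-- The Vandermonde-type alternant at the generic point, as a signed sum of monomials:
`a_μ(X) = ∑_τ sign(τ) X^{μ ∘ τ⁻¹}`. [folklore] -/
theorem alternant_X_eq_sum_monomial (μ : Fin N → ℕ) :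
    alternant (fun i => (X i : MvPolynomial (Fin N) ℤ)) μ =
      ∑ τ : Equiv.Perm (Fin N), ((Equiv.Perm.sign τ : ℤ) : MvPolynomial (Fin N) ℤ) *
        monomial (Finsupp.equivFunOnFinite.symm fun j => μ (τ⁻¹ j)) 1 := by
  rw [alternant_eq_sum]
  exact Finset.sum_congr rfl fun τ _ => by rw [prod_X_pow_perm_eq_monomial]

/-- Coefficients of `a_μ(X) · f`: `[x^α](a_μ f) = ∑_τ sign(τ) [x^{α - μ∘τ⁻¹}] f` (the term being
`0` unless `μ ∘ τ⁻¹ ≤ α`). [folklore] -/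
theorem coeff_alternant_mul (μ : Fin N → ℕ) (f : MvPolynomial (Fin N) ℤ) (α : Fin N →₀ ℕ) :
    coeff α (alternant (fun i => (X i : MvPolynomial (Fin N) ℤ)) μ * f) =
      ∑ τ : Equiv.Perm (Fin N), (Equiv.Perm.sign τ : ℤ) *
        (if (Finsupp.equivFunOnFinite.symm fun j => μ (τ⁻¹ j)) ≤ α then
          coeff (α - Finsupp.equivFunOnFinite.symm fun j => μ (τ⁻¹ j)) f else 0) := by
  rw [alternant_X_eq_sum_monomial, Finset.sum_mul, coeff_sum]
  refine Finset.sum_congr rfl fun τ _ => ?_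
  have hC : ((Equiv.Perm.sign τ : ℤ) : MvPolynomial (Fin N) ℤ) = C (Equiv.Perm.sign τ : ℤ) := by
    simp
  rw [hC, mul_assoc, coeff_C_mul, coeff_monomial_mul']
  simp

/-! ### Frobenius's alternating coefficient -/

/-- **Frobenius's alternating coefficient** `X^{lam}(σ) = [x^{lam + ρ}] (a_ρ(x) · F_σ(x)) ∈ ℤ`
for an exponent vector `lam ∈ ℕ^N`, `ρ = (N - 1, …, 1, 0)`, `a_ρ` the alternant and `F_σ` the
fixed-word enumerator (`= ∏ p_{cycle lengths}`): the right-hand side of Frobenius's character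
formula `χ_λ(C_𝐢) = [Δ(x) ∏_j P_j(x)^{i_j}]_{(ℓ_1, …, ℓ_N)}`, `ℓ_i = λ_i + N - i`
(Frobenius 1900; Fulton–Harris Thm. 4.10). That it equals the Specht character `χ^λ(σ)` when
`lam` lists the parts of `λ` (padded by zeros, `N ≥ ℓ(λ)`) is proved in
`SymmetricGroupFrobeniusFormula.lean`. [cite: FultonHarrisGTM129, Theorem 4.10 (4.10)] -/
def frobeniusChar (N : ℕ) (lam : Fin N → ℕ) (σ : Equiv.Perm ι) : ℤ :=
  coeff (Finsupp.equivFunOnFinite.symm (lam + rho N))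
    (alternant (fun i => (X i : MvPolynomial (Fin N) ℤ)) (rho N) * fixedWordPoly N σ)

/-- Unfolding `frobeniusChar`. [folklore] -/
theorem frobeniusChar_def (lam : Fin N → ℕ) (σ : Equiv.Perm ι) :
    frobeniusChar N lam σ = coeff (Finsupp.equivFunOnFinite.symm (lam + rho N))
      (alternant (fun i => (X i : MvPolynomial (Fin N) ℤ)) (rho N) * fixedWordPoly N σ) :=
  rfl

/-- Relabelling the positions does not change Frobenius's coefficient. [folklore] -/
theorem frobeniusChar_permCongr (lam : Fin N → ℕ) (e : ι ≃ κ) (σ : Equiv.Perm ι) :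
    frobeniusChar N lam (e.permCongr σ) = frobeniusChar N lam σ := by
  rw [frobeniusChar_def, frobeniusChar_def, fixedWordPoly_permCongr]

/-- **Frobenius's coefficient as an alternating sum of fixed-word counts** (the permutation-module
form of the right-hand side of Frobenius's formula, Fulton–Harris (4.39)–(4.41) with (4.33);
Macdonald I (7.6) with (7.2)): `X^{lam}(σ) = ∑_{τ ∈ 𝔖_N} sign(τ) · #{w | w ∘ σ = w and
ρ_{τ⁻¹ j} + cont(w)_j = lam_j + ρ_j for all j}` — the words counted for `τ` are those of content
`lam + ρ - ρ∘τ⁻¹` (none if this vector has a negative entry).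
[cite: FultonHarrisGTM129, §4.3 (4.41)] -/
theorem frobeniusChar_eq_sum_sign_mul_card (lam : Fin N → ℕ) (σ : Equiv.Perm ι) :
    frobeniusChar N lam σ = ∑ τ : Equiv.Perm (Fin N), (Equiv.Perm.sign τ : ℤ) *
      ((univ.filter fun w : ι → Fin N =>
        w ∘ ⇑σ = w ∧ ∀ j, rho N (τ⁻¹ j) + wordExps N w j = lam j + rho N j).card : ℤ) := by
  rw [frobeniusChar_def, coeff_alternant_mul]
  refine Finset.sum_congr rfl fun τ _ => ?_
  congr 1
  set d : Fin N →₀ ℕ := Finsupp.equivFunOnFinite.symm fun j => rho N (τ⁻¹ j) with hd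
  set α : Fin N →₀ ℕ := Finsupp.equivFunOnFinite.symm (lam + rho N) with hα
  by_cases hle : d ≤ α
  · rw [if_pos hle, coeff_fixedWordPoly]
    congr 2
    ext w
    simp only [mem_filter, mem_univ, true_and]
    refine and_congr_right fun _ => ?_
    constructor
    · intro h j
      have := DFunLike.congr_fun h j
      simp only [Finsupp.coe_tsub, Pi.sub_apply, hα, hd, Finsupp.coe_equivFunOnFinite_symm,
        Pi.add_apply] at this
      have hj := hle j
      simp only [hd, hα, Finsupp.coe_equivFunOnFinite_symm, Pi.add_apply] at hj
      omega
    · intro h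
      ext j
      simp only [Finsupp.coe_tsub, Pi.sub_apply, hα, hd, Finsupp.coe_equivFunOnFinite_symm,
        Pi.add_apply]
      have := h j
      omega
  · rw [if_neg hle]
    symm
    rw [Nat.cast_eq_zero, Finset.card_eq_zero, Finset.filter_eq_empty_iff]
    intro w _ ⟨_, h⟩
    apply hle
    intro j
    simp only [hd, hα, Finsupp.coe_equivFunOnFinite_symm, Pi.add_apply]
    have := h j
    omega

end Fixed

end Literature.RepresentationTheory.FiniteGroups

end
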